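import Mathlib
import Summits.QuantumFields.QCD.Theses.PauliWegnerSea
import Literature.MathematicalPhysics.QuantumFieldTheory.FermiFlavourPhase
import Literature.MathematicalPhysics.QuantumFieldTheory.QCDPhaseQuenchedReweighting
import Literature.MathematicalPhysics.QuantumLattice.GrassmannGaussianWordWick
import Literature.MathematicalPhysics.QuantumLattice.GrassmannMonomialCoefficients

/-!
# Stub `stub_wickExpansion` of line `crossing-split-integrability`
(crux `Summit.QuantumFields.QCD.Theses.PauliWegnerSea.PhaseQuenchedFlavourDecay` =
`Summit.QuantumFields.QCD.Theses.WilsonMobilityGap.PhaseQuenchedFlavourDecay`, item stmt-QuantumFields-9151)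

**Wick's theorem in determinant form for flavour-charged observables, as a deterministic pointwise
bound.**  For gauge-invariant local lattice-QCD observables `A` (flavour charge `q ≠ 0` under
`U(1)_{f₀}`) and `B`, there is a FIXED finite family (depending on `A, B, f₀, q` only) of two-box
index maps `κ, ρ` (rows `ψ`-variables, columns `ψ̄`-variables, every term with non-zero A-side
charge) and weights `c ≥ 0` such that on every torus `2S+1`, for every separation `n`, mass vector
and gauge field, `‖∫ A(0) B(n e₀) e^{-ψ̄Dψ} / ∫ e^{-ψ̄Dψ}‖ ≤ Σ_i c_i ‖det [D⁻¹_{κ_i a, ρ_i b}]‖`.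

Proof: expand `A.F U`, `B.F U` in the monomial bases (`exists_grassmannBasis_sumLex_eq`: every
monomial is a two-block word `ψ̄_i ψ_j`), bilinearity (`berezin_map_mul_map_mul`), coefficients
bounded uniformly in `U` through the Berezin pairing (`QCDLatticeObservable.bounded`,
`norm_repr_grassmannBasis`), coefficients of monomials of charge `≠ q` vanish
(`IsFlavourCharged`, `fermiFlavourPhase_grassmannBasis`, `sub_mul_repr_eq_zero_of_eigen` at the
angle `θ = π/(charge - q)`), `onTorus` relabels two-block words
(`map_relabel_prod_psiBar_mul_prod_psi`), words with `#ψ̄ ≠ #ψ` integrate to zero and the others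
are bounded by the norm of their Wick minor (`norm_berezin_fourBlock_mul_grassmannExp_div_le`,
which also covers `det D = 0` where the Lean ratio is `x / 0 = 0`).  The index set is the subtype of
pairs `(s, t)` of monomials with `charge(s) = q` and `#ψ̄ = #ψ`.
-/

noncomputable section

namespace Summit.QuantumFields.QCD.Cruxes.PhaseQuenchedFlavourDecay.CrossingSplitIntegrability

open scoped BigOperators
open MeasureTheory Filter
open Literature.MathematicalPhysics.QuantumFieldTheory Literature.MathematicalPhysics.QuantumLattice
  Literature.Probability.LatticeModels

/-- Bookkeeping of the double sum over pairs of monomials: terms outside `good` vanish, the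
others are bounded termwise. -/
private theorem norm_sum_sum_div_le {α β : Type*} [Fintype α] [Fintype β] (good : α × β → Prop)
    [DecidablePred good] (a : α → ℂ) (b : β → ℂ) (T : α → β → ℂ) (Z : ℂ) (CA : α → ℝ)
    (CB : β → ℝ) (m : {p // good p} → ℝ) (ha : ∀ s, ‖a s‖ ≤ CA s) (hb : ∀ t, ‖b t‖ ≤ CB t)
    (h0 : ∀ s t, ¬good (s, t) → a s * b t * T s t = 0)
    (h1 : ∀ p : {p // good p}, ‖T p.1.1 p.1.2 / Z‖ ≤ m p) :
    ‖(∑ s, ∑ t, a s * b t * T s t) / Z‖ ≤ ∑ p : {p // good p}, CA p.1.1 * CB p.1.2 * m p := by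
  have hsum : (∑ s, ∑ t, a s * b t * T s t) / Z =
      ∑ p : {p // good p}, a p.1.1 * b p.1.2 * T p.1.1 p.1.2 / Z := by
    simp_rw [Finset.sum_div]
    rw [← Fintype.sum_prod_type' fun s t => a s * b t * T s t / Z,
      ← Finset.sum_filter_of_ne (p := good) fun p _ hp => ?_]
    · exact Finset.sum_subtype _ (fun p => by simp) _
    · by_contra hg
      exact hp (by rw [h0 p.1 p.2 hg, zero_div])
  rw [hsum]
  refine (norm_sum_le _ _).trans (Finset.sum_le_sum fun p _ => ?_)
  rw [mul_div_assoc, norm_mul, norm_mul]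
  have ha0 : 0 ≤ CA p.1.1 := (norm_nonneg _).trans (ha _)
  exact mul_le_mul (mul_le_mul (ha _) (hb _) (norm_nonneg _) ha0) (h1 p) (norm_nonneg _)
    (mul_nonneg ha0 ((norm_nonneg _).trans (hb _)))

/-- **Charge selection, coefficientwise**: a monomial `θ_s` whose `U(1)_{f₀}` charge differs from
the charge `q` of a flavour-charged observable carries a zero coefficient in `A.F U`. -/
private theorem repr_eq_zero_of_charge_ne {Nf R : ℕ} {A : QCDLatticeObservable Nf R} {f₀ : Fin Nf}
    {q : ℤ} (hA : A.IsFlavourCharged f₀ q) (U : LGConfig 4 SU3)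
    (s : Finset (BoxFermiIdx Nf R ⊕ₗ BoxFermiIdx Nf R))
    (hs : (∑ w ∈ s, flavourChargeOf boxFlavour f₀ w) ≠ q) :
    (GrassmannAlgebra.grassmannBasis ℂ _).repr (A.F U) s = 0 := by
  set ch : ℤ := ∑ w ∈ s, flavourChargeOf boxFlavour f₀ w with hch
  have hne : ((ch : ℝ) - q : ℝ) ≠ 0 := by exact_mod_cast sub_ne_zero.2 hs
  set θ : ℝ := Real.pi / ((ch : ℝ) - q) with hθ
  have key := GrassmannAlgebra.sub_mul_repr_eq_zero_of_eigen ℂ (fermiFlavourPhase f₀ θ).toLinearMap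
    (fun t => Complex.exp (((((∑ w ∈ t, flavourChargeOf boxFlavour f₀ w : ℤ) : ℝ) * θ : ℝ) : ℂ) *
      Complex.I)) (fun t => fermiFlavourPhase_grassmannBasis f₀ θ t) (hA θ U) s
  refine (mul_eq_zero.1 key).resolve_left ?_
  have hchθ : ((ch : ℝ) * θ : ℝ) = (q : ℝ) * θ + Real.pi := by
    rw [hθ]
    field_simp
    ring
  have hexp : Complex.exp ((((ch : ℝ) * θ : ℝ) : ℂ) * Complex.I) =
      -Complex.exp ((((q : ℝ) * θ : ℝ) : ℂ) * Complex.I) := by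
    rw [hchθ, Complex.ofReal_add, add_mul, Complex.exp_add, Complex.exp_pi_mul_I, mul_neg_one]
  rw [← hch, hexp]
  intro h
  apply Complex.exp_ne_zero ((((q : ℝ) * θ : ℝ) : ℂ) * Complex.I)
  linear_combination (-1 / 2 : ℂ) * h

/-- Registered stub `stub_wickExpansion` of line `crossing-split-integrability` for crux stmt-QuantumFields-9151:
Wick's theorem in determinant form for flavour-charged observables (deterministic bound). -/
theorem stub_wickExpansion :
    ∀ Nf : ℕ,
      ∀ (R R' : ℕ) (A : QCDLatticeObservable Nf R) (B : QCDLatticeObservable Nf R') (f₀ : Fin Nf) (q : ℤ),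
        q ≠ 0 → A.IsFlavourCharged f₀ q →
        ∃ (ι : Type) (_ : Fintype ι) (r : ι → ℕ) (κ : (i : ι) → Fin (r i) → BoxQuarkVar Nf R ⊕ BoxQuarkVar Nf R')
          (ρ : (i : ι) → Fin (r i) → BoxQuarkVar Nf R ⊕ BoxQuarkVar Nf R') (c : ι → ℝ),
          (∀ i, 0 ≤ c i) ∧
          (∀ i, ((Finset.univ.filter fun a => Sum.isLeft (κ i a) = true ∧
              Sum.elim (fun v : BoxQuarkVar Nf R => v.1) (fun v : BoxQuarkVar Nf R' => v.1) (κ i a) = f₀).card : ℤ) -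
            ((Finset.univ.filter fun b => Sum.isLeft (ρ i b) = true ∧
              Sum.elim (fun v : BoxQuarkVar Nf R => v.1) (fun v : BoxQuarkVar Nf R' => v.1) (ρ i b) = f₀).card : ℤ) ≠ 0) ∧
          ∀ (S n : ℕ) (mq : Fin Nf → ℝ) (U : GaugeConfig 4 (2 * S + 1) SU3),
            ‖fermiIntegral (A.onTorus (2 * S + 1) 0 U * B.onTorus (2 * S + 1) (Pi.single 0 (n : ℤ)) U *
                  fermiBoltzmann U mq) / fermiIntegral (fermiBoltzmann U mq)‖ ≤
              ∑ i, c i * ‖(Matrix.of fun a b : Fin (r i) => (diracMatrix U mq)⁻¹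
                (quarkEquiv (Sum.elim
                  (fun v : BoxQuarkVar Nf R =>
                    (v.1, (Torus.proj (2 * S + 1) (v.2.1 : Literature.Probability.LatticeModels.Site 4), v.2.2)))
                  (fun v : BoxQuarkVar Nf R' =>
                    (v.1, (Torus.proj (2 * S + 1)
                      ((v.2.1 : Literature.Probability.LatticeModels.Site 4) + Pi.single 0 (n : ℤ)), v.2.2)))
                  (κ i a)))
                (quarkEquiv (Sum.elim
                  (fun v : BoxQuarkVar Nf R =>
                    (v.1, (Torus.proj (2 * S + 1) (v.2.1 : Literature.Probability.LatticeModels.Site 4), v.2.2)))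
                  (fun v : BoxQuarkVar Nf R' =>
                    (v.1, (Torus.proj (2 * S + 1)
                      ((v.2.1 : Literature.Probability.LatticeModels.Site 4) + Pi.single 0 (n : ℤ)), v.2.2)))
                  (ρ i b)))).det‖ := by
  intro Nf R R' A B f₀ q hq hA
  classical
  -- block data of the monomials of the two boxed Grassmann algebras
  choose kA lA iA jA hiA hjA hmemA hbasA using
    fun s : Finset (BoxFermiIdx Nf R ⊕ₗ BoxFermiIdx Nf R) => exists_grassmannBasis_sumLex_eq ℂ s
  choose kB lB iB jB hiB hjB hmemB hbasB using
    fun t : Finset (BoxFermiIdx Nf R' ⊕ₗ BoxFermiIdx Nf R') => exists_grassmannBasis_sumLex_eq ℂ t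
  -- uniform bounds of the coefficients (Berezin pairing with the complementary monomial)
  choose CA hCA using fun s : Finset (BoxFermiIdx Nf R ⊕ₗ BoxFermiIdx Nf R) =>
    A.bounded (GrassmannAlgebra.grassmannBasis ℂ _ sᶜ)
  choose CB hCB using fun t : Finset (BoxFermiIdx Nf R' ⊕ₗ BoxFermiIdx Nf R') =>
    B.bounded (GrassmannAlgebra.grassmannBasis ℂ _ tᶜ)
  -- the index set: pairs (A-monomial of charge `q`, B-monomial) with as many `ψ̄` as `ψ`
  obtain ⟨good, hgood⟩ : ∃ good : Finset (BoxFermiIdx Nf R ⊕ₗ BoxFermiIdx Nf R) ×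
      Finset (BoxFermiIdx Nf R' ⊕ₗ BoxFermiIdx Nf R') → Prop, ∀ p, good p ↔
        (∑ w ∈ p.1, flavourChargeOf boxFlavour f₀ w) = q ∧ lA p.1 + lB p.2 = kA p.1 + kB p.2 :=
    ⟨_, fun p => Iff.rfl⟩
  have hA_ch : ∀ s, ∑ w ∈ s, flavourChargeOf boxFlavour f₀ w =
      (∑ b : Fin (lA s), if (boxQuarkEquiv.symm (jA s b)).1 = f₀ then (1 : ℤ) else 0) -
        ∑ a : Fin (kA s), if (boxQuarkEquiv.symm (iA s a)).1 = f₀ then (1 : ℤ) else 0 := by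
    intro s
    rw [sum_eq_of_mem_iff_blocks (hiA s) (hjA s) (hmemA s), sub_eq_neg_add, ← Finset.sum_neg_distrib]
    simp only [flavourChargeOf_inl, flavourChargeOf_inr, boxFlavour]
    congr 1
    exact Finset.sum_congr rfl fun a _ => by split_ifs <;> simp
  refine ⟨{p // good p}, inferInstance, fun p => kA p.1.1 + kB p.1.2,
    fun p a => Fin.append (fun a => Sum.inl (boxQuarkEquiv.symm (jA p.1.1 a)))
      (fun b => Sum.inr (boxQuarkEquiv.symm (jB p.1.2 b))) (Fin.cast ((hgood _).1 p.2).2.symm a),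
    fun p b => Fin.append (fun a => Sum.inl (boxQuarkEquiv.symm (iA p.1.1 a)))
      (fun b => Sum.inr (boxQuarkEquiv.symm (iB p.1.2 b))) b,
    fun p => |CA p.1.1| * |CB p.1.2|, fun p => mul_nonneg (abs_nonneg _) (abs_nonneg _), ?_, ?_⟩
  · -- the A-side charge of every term is `q ≠ 0`
    rintro ⟨⟨s, t⟩, hp⟩
    obtain ⟨hsq, hcnt⟩ := (hgood _).1 hp
    have h := hq
    rw [← hsq, hA_ch s] at h
    convert h using 2
    · rw [Finset.card_filter, Nat.cast_sum, ← Fin.sum_congr' _ hcnt, Fin.sum_univ_add]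
      simp
    · rw [Finset.card_filter, Nat.cast_sum, Fin.sum_univ_add]
      simp
  · intro S n mq U
    set P : BoxQuarkVar Nf R ⊕ BoxQuarkVar Nf R' → QuarkVar Nf (2 * S + 1) := Sum.elim
      (fun v : BoxQuarkVar Nf R =>
        (v.1, (Torus.proj (2 * S + 1) (v.2.1 : Literature.Probability.LatticeModels.Site 4), v.2.2)))
      (fun v : BoxQuarkVar Nf R' =>
        (v.1, (Torus.proj (2 * S + 1)
          ((v.2.1 : Literature.Probability.LatticeModels.Site 4) + Pi.single 0 (n : ℤ)), v.2.2))) with hP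
    have hlA : ∀ x, QCDLatticeObservable.toTorusIdx (Nf := Nf) (R := R) (2 * S + 1) 0 (toLex (Sum.inl x)) =
        toLex (Sum.inl (quarkEquiv (P (Sum.inl (boxQuarkEquiv.symm x))))) := fun x => by
      simp [QCDLatticeObservable.toTorusIdx, hP]
    have hrA : ∀ x, QCDLatticeObservable.toTorusIdx (Nf := Nf) (R := R) (2 * S + 1) 0 (toLex (Sum.inr x)) =
        toLex (Sum.inr (quarkEquiv (P (Sum.inl (boxQuarkEquiv.symm x))))) := fun x => by
      simp [QCDLatticeObservable.toTorusIdx, hP]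
    have hlB : ∀ x, QCDLatticeObservable.toTorusIdx (Nf := Nf) (R := R') (2 * S + 1) (Pi.single 0 (n : ℤ))
        (toLex (Sum.inl x)) = toLex (Sum.inl (quarkEquiv (P (Sum.inr (boxQuarkEquiv.symm x))))) :=
      fun x => by simp [QCDLatticeObservable.toTorusIdx, hP]
    have hrB : ∀ x, QCDLatticeObservable.toTorusIdx (Nf := Nf) (R := R') (2 * S + 1) (Pi.single 0 (n : ℤ))
        (toLex (Sum.inr x)) = toLex (Sum.inr (quarkEquiv (P (Sum.inr (boxQuarkEquiv.symm x))))) :=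
      fun x => by simp [QCDLatticeObservable.toTorusIdx, hP]
    simp only [fermiIntegral, fermiBoltzmann, QCDLatticeObservable.onTorus]
    rw [GrassmannAlgebra.berezin_map_mul_map_mul]
    refine norm_sum_sum_div_le good _ _ _ _ (fun s => |CA s|) (fun t => |CB t|) _
      (fun s => ?_) (fun t => ?_) (fun s t hst => ?_) ?_
    · rw [GrassmannAlgebra.norm_repr_grassmannBasis]
      exact (hCA s _).trans (le_abs_self _)
    · rw [GrassmannAlgebra.norm_repr_grassmannBasis]
      exact (hCB t _).trans (le_abs_self _)
    · rcases not_and_or.1 (fun h => hst ((hgood _).2 h)) with h | h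
      · rw [repr_eq_zero_of_charge_ne hA _ s h, zero_mul, zero_mul]
      · rw [hbasA s, hbasB t, map_relabel_prod_psiBar_mul_prod_psi ℂ _ _ _ hlA hrA,
          map_relabel_prod_psiBar_mul_prod_psi ℂ _ _ _ hlB hrB,
          berezin_fourBlock_mul_grassmannExp_quadratic_eq_zero ℂ _ _ _ _ _ h, mul_zero]
    · rintro ⟨⟨s, t⟩, hp⟩
      obtain ⟨-, hcnt⟩ := (hgood _).1 hp
      dsimp only
      rw [hbasA s, hbasB t, map_relabel_prod_psiBar_mul_prod_psi ℂ _ _ _ hlA hrA,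
        map_relabel_prod_psiBar_mul_prod_psi ℂ _ _ _ hlB hrB]
      refine (norm_berezin_fourBlock_mul_grassmannExp_div_le (diracMatrix U mq) _ _ _ _ hcnt).trans
        (le_of_eq ?_)
      congr 2
      ext a b
      simp only [Matrix.of_apply]
      exact congrArg₂ (fun x y => (diracMatrix U mq)⁻¹ x y)
        (congrFun (comp_fin_append (fun y => quarkEquiv (P y)) _ _) _).symm
        (congrFun (comp_fin_append (fun y => quarkEquiv (P y)) _ _) _).symm

end Summit.QuantumFields.QCD.Cruxes.PhaseQuenchedFlavourDecay.CrossingSplitIntegrability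

end
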